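import Summits.BirchSwinnertonDyer.BirchSwinnertonDyer.Theorems.ManinLocalTwoThreeConwayNortonLeRamanujan
import Summits.BirchSwinnertonDyer.BirchSwinnertonDyer.Theorems.ManinLocalTwoThreeTranslationNewform
import HarnessLib

/-!
# The `f`-line index is monotone in the lattice: `r_M(f) ∣ r_{M′}(f)` for `f ∈ M ≤ M′`; `r_R(f) ∣ r_G(f) ∣ r_{AL}(f) ∣ r_f`

Summit `BirchSwinnertonDyer`, sub-problem `BirchSwinnertonDyer`, route `ManinLocalTwoThree`; width seat `bsd-line-manin23-p2`
(gen 9), `--supports` the crux C3 `ManinPrimeToThreeAtNine` (stmt-BirchSwinnertonDyer-22968).  Cell `bsd-f2-manin`, descent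
lens: desc's cut lattices `S^T ≤ S^R ≤ S^{AL} ≤ S` (at `3`) and `S^G ≤ S^{AL} ≤ S` (at `2`) carry `f`-line indices
`r_T, r_R, r_G, r_{AL}` and `r_f = congruenceNumber f` (`lineIndex_integralCuspForms0`, definitional); the census tables
(MEMO-desc §21–§25) compare them.  This file records the formal divisibilities and chains them with the upper half of
E-desc-56 (`eisensteinDepth_conwayNorton_le`, sibling file `ManinLocalTwoThreeConwayNortonLeRamanujan`).

PROVED here (sorry-free):
* `lineIndex_eq_relIndex` — `lineIndex M h = [⟨h, M⟩ : ⟨h, M ∩ ℤh⟩]` (first isomorphism theorem; `0` iff infinite);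
* **`lineIndex_dvd_of_le`** — `M ≤ M′`, `f ∈ M` ⟹ `lineIndex M f ∣ lineIndex M′ f`;
* `lineIndex_ramanujan_dvd_congruenceNumber`, `lineIndex_conway_dvd_congruenceNumber`, `lineIndex_ramanujan_dvd_lineIndex_al`,
  `lineIndex_conway_dvd_lineIndex_al`, `lineIndex_al_dvd_congruenceNumber` (for the newform of a modular parametrisation
  datum at `9 ∣ N` resp. `4 ∣ N`, which lies in `S^R` resp. `S^G`);
* **`eisensteinDepth_conwayNorton_le_congruenceNumber`** — `k(f) ≤ 2 · ord₃ r_f` for `f ∈ M^G ∩ S^R` with `r_f ≠ 0`, and its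
  E-facing instance `eisensteinDepth_le_congruenceNumber_of_isIsogenous_quadraticTwist_negThree` (same-conductor `(−3)`-twist
  pairs): the `(√−3)`-adic Eisenstein depth of the Conway–Norton plane is bounded by twice the `3`-adic valuation of the
  CONGRUENCE NUMBER.

Elementary.  BSD is not proved by this; Manin's conjecture is not proved by this.
-/

set_option autoImplicit false
set_option linter.dupNamespace false

noncomputable section

open scoped MatrixGroups ModularForm
open CongruenceSubgroup WeierstrassCurve
open Literature.NumberTheory.EllipticCurves Literature.NumberTheory.EllipticCurves.ModularForms
open Summit.BirchSwinnertonDyer.Rank1Residual.ManinAdditive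
open Summit.BirchSwinnertonDyer.Rank1Residual.ManinAdditive.RamanujanCut
open Summit.BirchSwinnertonDyer.Rank1Residual.ManinAdditive.ConwayCut
open Summit.BirchSwinnertonDyer.Rank1Residual.ManinAdditive.ConwayNortonThree

namespace Summit.BirchSwinnertonDyer.BirchSwinnertonDyer.Theorems.ManinLocalTwoThree

variable {N : ℕ} [NeZero N]

/-- **The line index through the Petersson functional**: with `L_h = ⟨h, ·⟩`,
`lineIndex M h = [L_h(M) : L_h(M ∩ ℤh)]` as additive subgroups of `ℂ` (`0` for an infinite index on both sides). -/
theorem lineIndex_eq_relIndex (M : Submodule ℤ (CuspForm (Gamma0 N) 2)) (h : CuspForm (Gamma0 N) 2) :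
    lineIndex M h =
      ((M ⊓ (ℤ ∙ h)).toAddSubgroup.map (peterssonProductₗ (Gamma0 N) 2 h).toAddMonoidHom).relIndex
        (M.toAddSubgroup.map (peterssonProductₗ (Gamma0 N) 2 h).toAddMonoidHom) := by
  set L := (peterssonProductₗ (Gamma0 N) 2 h).toAddMonoidHom with hL
  set P : Submodule ℤ (CuspForm (Gamma0 N) 2) := (ℤ ∙ h) with hP
  let φ : M →+ ℂ := L.comp M.subtype.toAddMonoidHom
  have hφ : ∀ x : M, φ x = peterssonProduct (Gamma0 N) 2 h x := fun x => rfl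
  have hLx : ∀ x : CuspForm (Gamma0 N) 2, L x = peterssonProduct (Gamma0 N) 2 h x := fun x => rfl
  have hrange : φ.range = M.toAddSubgroup.map L := by
    ext z
    constructor
    · rintro ⟨x, rfl⟩
      exact ⟨x, x.2, rfl⟩
    · rintro ⟨x, hx, rfl⟩
      exact ⟨⟨x, hx⟩, rfl⟩
  have hQ : ((P ⊔ (M ⊓ (LinearMap.ker (peterssonProductₗ (Gamma0 N) 2 h)).restrictScalars ℤ)).comap
      M.subtype).toAddSubgroup = ((M ⊓ P).toAddSubgroup.map L).comap φ := by
    ext x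
    simp only [Submodule.mem_toAddSubgroup, Submodule.mem_comap, AddSubgroup.mem_comap, AddSubgroup.mem_map,
      Submodule.coe_subtype]
    constructor
    · intro hx
      obtain ⟨y, hy, z, hz, hyz⟩ := Submodule.mem_sup.mp hx
      obtain ⟨hzM, hzk⟩ := Submodule.mem_inf.mp hz
      have hyM : y ∈ M := by
        have : y = (x : CuspForm (Gamma0 N) 2) - z := by rw [← hyz, add_sub_cancel_right]
        rw [this]
        exact M.sub_mem x.2 hzM
      refine ⟨y, Submodule.mem_inf.mpr ⟨hyM, hy⟩, ?_⟩
      rw [Submodule.restrictScalars_mem, LinearMap.mem_ker, peterssonProductₗ_apply] at hzk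
      rw [hφ, hLx, ← hyz, peterssonProduct_add_right, hzk, add_zero]
    · rintro ⟨w, hw, hwx⟩
      obtain ⟨hwM, hwP⟩ := Submodule.mem_inf.mp hw
      rw [hφ, hLx] at hwx
      refine Submodule.mem_sup.mpr ⟨w, hwP, (x : CuspForm (Gamma0 N) 2) - w,
        Submodule.mem_inf.mpr ⟨M.sub_mem x.2 hwM, ?_⟩, add_sub_cancel w _⟩
      rw [Submodule.restrictScalars_mem, LinearMap.mem_ker, peterssonProductₗ_apply, peterssonProduct_sub_right',
        hwx, sub_self]
  unfold lineIndex
  rw [natCard_quotient_eq_index, hQ, AddSubgroup.index_comap, hrange]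

/-- **Monotonicity of the line index**: for `f ∈ M ≤ M′`, `lineIndex M f ∣ lineIndex M′ f`
(`ℤ⟨f,f⟩ ≤ ⟨f, M⟩ ≤ ⟨f, M′⟩`). -/
theorem lineIndex_dvd_of_le {M M' : Submodule ℤ (CuspForm (Gamma0 N) 2)} (hMM' : M ≤ M') {f : CuspForm (Gamma0 N) 2}
    (hf : f ∈ M) : lineIndex M f ∣ lineIndex M' f := by
  set L := (peterssonProductₗ (Gamma0 N) 2 f).toAddMonoidHom with hL
  have hMf : M ⊓ (ℤ ∙ f) = ℤ ∙ f := inf_eq_right.mpr ((Submodule.span_singleton_le_iff_mem _ _).mpr hf)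
  have hM'f : M' ⊓ (ℤ ∙ f) = ℤ ∙ f := inf_eq_right.mpr ((Submodule.span_singleton_le_iff_mem _ _).mpr (hMM' hf))
  rw [lineIndex_eq_relIndex, lineIndex_eq_relIndex, hMf, hM'f]
  have h1 : (ℤ ∙ f).toAddSubgroup.map L ≤ M.toAddSubgroup.map L :=
    AddSubgroup.map_mono (fun x hx => (Submodule.span_singleton_le_iff_mem _ _).mpr hf hx)
  have h2 : M.toAddSubgroup.map L ≤ M'.toAddSubgroup.map L := AddSubgroup.map_mono (fun x hx => hMM' hx)
  exact Dvd.intro _ (AddSubgroup.relIndex_mul_relIndex _ _ _ h1 h2)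

/-- `r_{AL}(D.f) ∣ r_f` for every modular parametrisation datum (`D.f ∈ S^{AL}`). -/
theorem lineIndex_al_dvd_congruenceNumber {W : WeierstrassCurve ℚ} [W.IsElliptic] (D : ModularParametrizationData W N) :
    lineIndex (alStableLattice N) D.f ∣ congruenceNumber D.f := by
  rw [← lineIndex_integralCuspForms0]
  exact lineIndex_dvd_of_le alStableLattice_le
    (f_mem_alStableLattice D IsNewform0.exists_atkinLehnerInvolutionAt_eq_smul_holds)

/-- `r_R(D.f) ∣ r_{AL}(D.f)` (`9 ∣ N`). -/
theorem lineIndex_ramanujan_dvd_lineIndex_al (h9 : 9 ∣ N) {W : WeierstrassCurve ℚ} [W.IsElliptic]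
    (D : ModularParametrizationData W N) :
    lineIndex (ramanujanStableLattice N) D.f ∣ lineIndex (alStableLattice N) D.f :=
  lineIndex_dvd_of_le ramanujanStableLattice_le_alStableLattice (f_mem_ramanujanStableLattice h9 D)

/-- **`r_R(D.f) ∣ r_f`** (`9 ∣ N`). -/
theorem lineIndex_ramanujan_dvd_congruenceNumber (h9 : 9 ∣ N) {W : WeierstrassCurve ℚ} [W.IsElliptic]
    (D : ModularParametrizationData W N) :
    lineIndex (ramanujanStableLattice N) D.f ∣ congruenceNumber D.f := by
  rw [← lineIndex_integralCuspForms0]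
  exact lineIndex_dvd_of_le (ramanujanStableLattice_le_alStableLattice.trans alStableLattice_le)
    (f_mem_ramanujanStableLattice h9 D)

/-- `r_G(D.f) ∣ r_{AL}(D.f)` (`4 ∣ N`). -/
theorem lineIndex_conway_dvd_lineIndex_al (h4 : 4 ∣ N) {W : WeierstrassCurve ℚ} [W.IsElliptic]
    (D : ModularParametrizationData W N) :
    lineIndex (conwayStableLattice N) D.f ∣ lineIndex (alStableLattice N) D.f :=
  lineIndex_dvd_of_le conwayStableLattice_le_alStableLattice (f_mem_conwayStableLattice h4 D)

/-- **`r_G(D.f) ∣ r_f`** (`4 ∣ N`). -/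
theorem lineIndex_conway_dvd_congruenceNumber (h4 : 4 ∣ N) {W : WeierstrassCurve ℚ} [W.IsElliptic]
    (D : ModularParametrizationData W N) :
    lineIndex (conwayStableLattice N) D.f ∣ congruenceNumber D.f := by
  rw [← lineIndex_integralCuspForms0]
  exact lineIndex_dvd_of_le conwayStableLattice_le (f_mem_conwayStableLattice h4 D)

/-- **`k(f) ≤ 2 · ord₃ r_f`** for `f ∈ M^G ∩ S^R` (`9 ∣ N`) with finite congruence number: the upper half of E-desc-56 chained
with `r_R(f) ∣ r_f`. -/
theorem eisensteinDepth_conwayNorton_le_congruenceNumber (h9 : 9 ∣ N) {f : CuspForm (Gamma0 N) 2}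
    (hfM : f ∈ conwayNortonLatticeAtThree N) (hfR : f ∈ ramanujanStableLattice N) (hr : congruenceNumber f ≠ 0) :
    eisensteinDepth (conwayNortonLatticeAtThree N) f ≤ 2 * padicValNat 3 (congruenceNumber f) := by
  haveI : Fact (Nat.Prime 3) := ⟨Nat.prime_three⟩
  have hdvd : lineIndex (ramanujanStableLattice N) f ∣ congruenceNumber f := by
    rw [← lineIndex_integralCuspForms0]
    exact lineIndex_dvd_of_le (ramanujanStableLattice_le_alStableLattice.trans alStableLattice_le) hfR
  have hrR : lineIndex (ramanujanStableLattice N) f ≠ 0 := fun h0 => hr (zero_dvd_iff.mp (h0 ▸ hdvd))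
  calc eisensteinDepth (conwayNortonLatticeAtThree N) f
      ≤ 2 * padicValNat 3 (lineIndex (ramanujanStableLattice N) f) := eisensteinDepth_conwayNorton_le h9 hfM hrR
    _ ≤ 2 * padicValNat 3 (congruenceNumber f) :=
        Nat.mul_le_mul_left 2 ((padicValNat_dvd_iff_le hr).mp (pow_padicValNat_dvd.trans hdvd))

/-- **E-facing instance**: for data `D, D′` of `W, W′` at a common level `9 ∣ N`, `9 ∣ N_{W′}`, `W ⊗ (−3) ∼ W′`, and
`r_{D.f} ≠ 0`: `k(D.f) ≤ 2 · ord₃ r_{D.f}`. -/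
theorem eisensteinDepth_le_congruenceNumber_of_isIsogenous_quadraticTwist_negThree {W W' : WeierstrassCurve ℚ}
    [W.IsElliptic] [W'.IsElliptic] (D : ModularParametrizationData W N) (D' : ModularParametrizationData W' N)
    (h9 : 9 ∣ N) (h9W' : 9 ∣ W'.conductorNorm ℤ) (hiso : IsIsogenous (W.quadraticTwist ((-3 : ℤ) : ℚ)) W')
    (hr : congruenceNumber D.f ≠ 0) :
    eisensteinDepth (conwayNortonLatticeAtThree N) D.f ≤ 2 * padicValNat 3 (congruenceNumber D.f) :=
  eisensteinDepth_conwayNorton_le_congruenceNumber h9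
    (mem_conwayNorton_of_isIsogenous_quadraticTwist_negThree D D' (by simpa using h9) h9W' hiso).1
    (f_mem_ramanujanStableLattice h9 D) hr

end Summit.BirchSwinnertonDyer.BirchSwinnertonDyer.Theorems.ManinLocalTwoThree

end
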